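import Summits.HodgeConjecture.HodgeConjecture.Theorems.MarkmanPartnerTransportK3Sq2TypeHodgeOfPicardThree
import Summits.HodgeConjecture.HodgeConjecture.Theorems.MarkmanPartnerTransportPartnerTransportPicardRank
import Literature.AlgebraicGeometry.HodgeTheory.ComplexOrientationFamily

/-!
# Route MarkmanPartnerTransport · target `K3Sq2TypeHodge` (stmt-HodgeConjecture-19649) —
# MONOTONE TRANSFER: K3-square theorems above a Picard rank give `K3^{[2]}`-type theorems above that rank

The route's transfer principle in its rank-indexed form: since a K3 partner `S` of a marked `K3^{[2]}`-type
fourfold `X` realised on Beauville's marked Hilbert square has `ρ(X) ≤ ρ(S) + 1`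
(`finrank_algebraicClasses_le_partner_succ`), every theorem «`HC⁴(S × S)` for all marked projective K3
surfaces `S` with `ρ(S) ≥ r − 1`» yields «`HC⁴(X)` for all marked projective `K3^{[2]}`-type `X` with
`ρ(X) ≥ max(r, 4)`», modulo the five named facts of `PartnerExistence` + `PartnerTransport`.

* `hodgeConjectureFor_of_squares_from_rank` — the transfer (the `ρ(X) ≥ 18` sector
  `hodgeConjectureFor_of_eighteen_le` is the instance `r = 18` fed with the `ρ(S) ≥ 17` K3-square theorem;
  future K3-square sectors at lower `ρ(S)` transfer by the same term).

Pure logic over landed theorems; CONDITIONAL (credits nothing). No definition, no sorry.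
Prover seat hodge-nonav-19652-p1 (gen 6), `--supports stmt-HodgeConjecture-19649`.

References: E. Markman, Compos. Math. 160 (2024) Thm. 1.1/1.4; A. Beauville, J. Differential Geom. 18 (1983)
§6 Prop. 6 and Remarque; D. Huybrechts, *Lectures on K3 Surfaces* Ch. 6–7.
-/

noncomputable section

set_option linter.dupNamespace false

open Module CategoryTheory MonoidalCategory
open Literature.AlgebraicTopology.SingularHomology
open Literature.AlgebraicGeometry Literature.AlgebraicGeometry.Motives Literature.AlgebraicGeometry.HodgeTheory
open Literature.AlgebraicGeometry.Hyperkaehler Literature.AlgebraicGeometry.Surfaces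
open Literature.AlgebraicGeometry.HilbertScheme

namespace Summit.HodgeConjecture.HodgeConjecture.Theorems.MarkmanPartnerTransport.PartnerLattice

/-- `MarkedK3Sq[X, φ, P, z]`: VERBATIM the `let MarkedK3Sq := …` binder of the route declarations of
MarkmanPartnerTransport (clauses (m1)–(m6)). Local notation only. -/
local notation3 (prettyPrint := false) "MarkedK3Sq[" X ", " φ ", " P ", " z "]" =>
  (((IsIntegralClass P ∧ ∀ Q : complexBetti X (2 * 4), IsIntegralClass Q → ∃ n : ℤ, Q = n • P) ∧
    (∀ c : complexBetti X 2, IsIntegralClass c ↔ ∃ v : K3HilbertIndex → ℤ, φ c = fun i => (v i : ℂ)) ∧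
    (∀ a : complexBetti X 2, cupPowTwo a 4 = ((3 : ℂ) * (k3HilbertForm 2 (φ a) (φ a)) ^ 2) • P) ∧
    (IsOfHodgeType 4 X 2 2 0 (LinearEquiv.symm φ z) ∧
      ∀ τ : complexBetti X 2, IsOfHodgeType 4 X 2 2 0 τ → ∃ t : ℂ, τ = t • LinearEquiv.symm φ z) ∧
    (∀ c : complexBetti X 2, IsOfHodgeType 4 X 2 1 1 c ↔
      (k3HilbertForm 2 (φ c) z = 0 ∧ k3HilbertForm 2 (φ c) (star z) = 0)) ∧
    (k3HilbertForm 2 z z = 0 ∧ 0 < (k3HilbertForm 2 (star z) z).re)))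

/-- `MarkedK3P[S, η, p, x]`: VERBATIM the `let MarkedK3 := …` binder of the route declarations (marked
projective K3 surface). Local notation only. -/
local notation3 (prettyPrint := false) "MarkedK3P[" S ", " η ", " p ", " x "]" =>
  (p ≠ 0 ∧ (IsIntegralClass p ∧ (∀ q : complexBetti S (2 * 2), IsIntegralClass q → ∃ n : ℤ, q = n • p) ∧
    (∀ c : complexBetti S (2 * 1), IsIntegralClass c ↔ ∃ v : K3Index → ℤ, η c = fun i => (v i : ℂ)) ∧
    (∀ a b : complexBetti S (2 * 1), cupProduct (rfl : 2 * 1 + 2 * 1 = 2 * 2) a b = k3Form (η a) (η b) • p) ∧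
    IsOfHodgeType 2 S (2 * 1) 2 0 (LinearEquiv.symm η x) ∧
    (∀ τ : complexBetti S (2 * 1), IsOfHodgeType 2 S (2 * 1) 2 0 τ → ∃ t : ℂ, τ = t • LinearEquiv.symm η x)) ∧
    (k3Form x x = 0 ∧ 0 < (k3Form (star x) x).re ∧ ∃ u : K3Index → ℤ,
      k3Form (fun i => (u i : ℂ)) x = 0 ∧ 0 < ∑ i, ∑ j, u i * k3Gram i j * u j))

/-- **Monotone transfer** (module docstring): `HC⁴(S × S)` for all marked projective K3 surfaces with
`ρ(S) + 1 ≥ r` implies `HC⁴(X)` for all marked projective `K3^{[2]}`-type fourfolds with `ρ(X) ≥ r` and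
`ρ(X) ≥ 4`, modulo the five named facts. [cite: Markman2024, §1.1 Thm. 1.1 and Thm. 1.4]
[cite: Beauville1983, §6 Prop. 6 and Remarque] [cite: Huybrechts2016K3, Ch. 6 Thm. 3.1 and Ch. 7 Thm. 4.1] -/
theorem hodgeConjectureFor_of_squares_from_rank (hP : Huybrechts_K3_periodSurjective_projective)
    (hB : Beauville1983_hilbertSquare_markedIncidence)
    (hρ : Beauville1983_hilbertSquare_blowupDiagonal_surjection)
    (hMk : Markman2024_rationalHodgeIsometry_lift_algebraic_marked)
    (hcup : Voisin2003_cupProduct_algebraicClasses) (r : ℕ)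
    (hsq : ∀ (S : SchemeOver ℂ), IsK3Surface S → ∀ (η : complexBetti S (2 * 1) ≃ₗ[ℂ] (K3Index → ℂ))
      (p : complexBetti S (2 * 2)) (x : K3Index → ℂ), MarkedK3P[S, η, p, x] →
      r ≤ Module.finrank ℂ (algebraicClasses S 1) + 1 → HodgeConjectureFor 4 (S ⊗ S))
    {X : SchemeOver ℂ} (hX : IsSmoothProjective 4 X) (hK : IsOfK3HilbertSquareType X)
    {φ : complexBetti X 2 ≃ₗ[ℂ] (K3HilbertIndex → ℂ)} {P : complexBetti X (2 * 4)} {z : K3HilbertIndex → ℂ}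
    (hM : MarkedK3Sq[X, φ, P, z]) (h4 : 4 ≤ Module.finrank ℂ (algebraicClasses X 1))
    (hr : r ≤ Module.finrank ℂ (algebraicClasses X 1)) : HodgeConjectureFor 4 X := by
  refine hodgeConjectureFor_of_square_partner hP hB hρ hMk hcup hX hK hM h4 ?_
  intro S hS η p x g hSm hg _
  obtain ⟨hp0, hmk, hxx, hxpos, hu⟩ := hSm
  have hμ := hasPoincareDuality_complexOrientationFamily
  obtain ⟨H, hH, Ξ, φH, PH, -, -, hMH, θ, hθ, hi⟩ := hB complexOrientationFamily hμ S hS η p x hmk hxx hxpos hu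
  have hle := finrank_algebraicClasses_le_partner_succ hcup hμ hX hM hS hp0 hmk.2.2.1 hmk.2.2.2.1
    hmk.2.2.2.2.1 hxpos hH hMH hθ hi hg.1 hg.2.2.2.1 hg.2.2.2.2.1
  exact hsq S hS η p x ⟨hp0, hmk, hxx, hxpos, hu⟩ (hr.trans hle)

end Summit.HodgeConjecture.HodgeConjecture.Theorems.MarkmanPartnerTransport.PartnerLattice

end
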